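import Summits.QuantumFields.YangMills.Theorems.BalabanUVNodesN11Sect3SupplyChainBorelBThm1PrintedOfLogScalars
import Summits.QuantumFields.YangMills.Theorems.BalabanUVNodesN11NodeFaceOfCompatibleSupplyChain

/-!
# DAG node N11 — THE COMPATIBLE HALF OF N11's NODE ON THE SupplierBorel ROAD WITH K0's GUARDED ROW ONLY: `Dag.B14_main (leavesP w p)` on every run whose TOP 𝐃_K-cube fits
# (resp. above the floor, resp. in [I] Thm 2's regime), the run guard `PartCompat₁₃` PRODUCED INSIDE THE NODE from its own antecedents `smallCouplings` + `flowControl` ((2.6),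
# dag-n11-w4 g5) and fed to this seat's E token — NO bg-fact binder, NO guard binder; the complement (top cube does not fit) is the bg-facts road of this seat's FILE 1

HEADER — WORK-UNIT METADATA.  Cell `pub-ymgap`, YM-PLAN Track A (HUMAN RULING D-0062 ∕ D-0149 width seats), seat `pub-ymgap-dag-n11-w1` (g4; WIDTH SEAT 1 of 4 on NODE
n11 [B14]), route `BalabanUVNodes` rev 29, KEY item K1⁹ `StabilityBRunRowsAtRecordR13SepCoPHV` = stmt-QuantumFields-27364 (dag-lead KEY MAP v2; helper lane, `--kind proof
--supports 27364 --as helper`, count-neutral; seat payload key K1⁷ 20542 = MIS-KEY fallback).  [III] = [Balaban1988Convergent], [I] = [Balaban1987RG1], [V] = [Balaban1989LargeFieldII],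
[IV] = [Balaban1989LargeFieldI], [15] = [Balaban1985Variational].  Over this seat's E `…Sect3SupplyChainBorelBThm1PrintedOfLogScalars` (p613848:
`supplyChainAt_of_gaussCert_of_supplierBorel_of_nesting_of_logScalars` — the token with the guard `hPC` displayed, K0's GUARDED row `Provisos₁₃SepCoPH.bg` read inside) and dag-n11-w4
g5's `…N11NodeFaceOfCompatibleSupplyChain` (p-landed: `b14_main_leavesP_of_supplyChainAt_of_compatible_of_topDvd ∕ _of_floor`, `b14_main_leavesP_of_thm2Regime_of_supplyChainAt_of_compatible` —
the generic-chain node faces with `hN : window → PartCompat₁₃ → SupplyChainAt`, the guard from (2.6) by their `…N11RunGuardOfFlowControl`).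

WHY THIS FILE.  dag-n11-w4 g4 LOCATED the run guard as a floor on the last coupling (its ∀-window binder UNSATISFIABLE), and the plan priced the hole as SCOPE∕SUPPLY: on COMPATIBLE runs
print's partitions and K0's guarded row apply as is; below the floor the partition is one-block and the bg CONTENT must be supplied (BG-ONEBLOCK).  This seat typed both consumer sides of
the BorelB road: H4 (the compatible half, guard from a β-ceiling + floor letter) and H3 ∕ H5 ∕ FILE 1 (the guard-free bg-facts editions).  dag-n11-w4 g5 then showed the guard needs NO
β-leaf: INSIDE N11's node it follows from the node's own antecedents `smallCouplings` + `flowControl` ((2.6)) plus ONE divisibility (the top cube fits), and typed the node face for a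
GENERIC chain keyed `hN : window → PartCompat₁₃ θ p p.K → SupplyChainAt θ p`.  THIS FILE is the BorelB instance: E's token IS such an `hN` (window transferred by `w.γ ≤ θ.γ`), so on
every run whose top cube fits N11's node holds from the Gaussian certificate, `2 ≤ cR`, the `M₂`-light log scalars, K0's per-cube [15]-solvability and [III] §3's supplier with
`SupplierObligations ∧ SupplierBorel` — with NEITHER a guard binder NOR a bg-fact binder (§1 per run: top cube ∕ floor; §2 ∀ runs whose top cube fits; §3 [I] Thm 2's regime: ONE
world-level divisibility; §4 the named certificate `gaussPinH θ`).  Together with FILE 1 (bg-facts road, all window runs) the BorelB road's node layer now covers both halves of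
dag-n11-w4's two-regime split.

WHAT THIS FILE PROVES (6 theorems, 0 `def`, 0 `sorry`; standard axioms; compositions BY NAME).
§1 ★★ `b14_main_leavesP_of_gaussCert_of_supplierBorel_of_logScalars_of_topDvd` · ★★ `b14_main_leavesP_of_gaussCert_of_supplierBorel_of_logScalars_of_floor`.
§2 ★★★ `b14_main_leavesP_all_of_gaussCert_of_supplierBorel_of_logScalars_of_topDvd`.
§3 ★★★ `b14_main_leavesP_all_of_thm2Regime_of_gaussCert_of_supplierBorel_of_logScalars`.
§4 ★★ `b14_main_leavesP_all_gaussPinH_of_supplierBorel_of_logScalars_of_topDvd` · ★★ `b14_main_leavesP_all_gaussPinH_of_thm2Regime_of_supplierBorel_of_logScalars`.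

HONEST FRAMING.  Helper lane of K1⁹; count-neutral KERNEL COMPOSITION of landed theorems; every analytic row is a DISPLAYED HYPOTHESIS exactly as in E: the certificate (none at
`gaussPinH θ`), the K1-keyed `Provisos₁₃SepCoPH` (whose guarded row `bg` is K0's), the live-selector line, admissibility, signs, `0 < M₁ ≤ M`, `2 ≤ cR` (UNINHABITED at the witnesses of
record; live at a cR-lettered member), `L·M₂ ∣ M`, the log scalars, `M = L^a`, `r = 1`, the world letters `0 ≤ βup`, `βup·γ² ≤ 1` (resp. the floor ∕ the divisibility), and per run K0's
per-cube [15]-solvability and [III] §3's supplier (= Thm 2 proper — nobody's theorem).  Nothing of Bałaban asserted; no statement about runs whose top cube does not fit; no v9 stub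
touched; K1⁹ NOT closed; N11 NOT discharged; counts unmoved (typed 28∕28 · discharged 5∕27 · A 5∕28).  One finite `𝕋⁴_{L^K}` programme at fixed `ε = L^{−K}`; R4 closes only the
conditional finite-𝕋⁴ rung `BalabanLadder.UV` — NOT ℝ⁴, NOT OS, NOT a mass gap, NOT Clay.  No `sorry`, `axiom`, `def`, `instance`, `notation`.
Sources (SHAPE ∕ bookkeeping only): [III] Thm 1 p.262, Theorem p.245, p.244 L36–38, §3 p.279, (2.1) p.254, (2.4)–(2.6) p.255, p.257 («compatible»), (2.28) p.259, (3.24)–(3.25) p.270;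
[I] Thm 1 + Thm 2 p.259, (0.20) p.256, (0.31) p.259, (1.20)–(1.22) p.264; [V] Thm 1 p.355; [IV] (0.3)–(0.4) p.176, p.177 (i)–(ii); [15] Thm 1 (7)–(8) pp.278–279.
-/

noncomputable section

open MeasureTheory
open scoped BigOperators ENNReal NNReal Matrix.Norms.L2Operator

namespace Summit.QuantumFields.YangMills.Theorems.BalabanUVNodesN11NodeFaceOfCompatibleSupplierBorel

open Literature.MathematicalPhysics.QuantumFieldTheory.Balaban1983to89 T4Continuum T4NestedCovariance Node00 Node00.Tk DagBinding
open B15DeterminingSets B8Eq17ClassAkV1 B14.Eq218Concrete B10Eq42TorusConstraint Step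
open B14.Eq213MaximalDomains (side)
open B14.Eq213DetSet (Bj)
open Literature.MathematicalPhysics.QuantumFieldTheory.BalabanImbrieJaffe1984to88.BIJ85Eq453GaugeField (qsstarGIter0)
open BalabanUVNodesN11HistoryPinnedResidualDefs BalabanUVNodesN11RePinnedParamDefs
open BalabanUVNodesN11GaussianCertificateDefs (gaussPinH gaussPinH_ζ0 gaussPinH_quad)
open BalabanUVNodesN11Sect3SupplyChainDefs
open BalabanUVNodesN11Sect3SupplyChainBorelB
open BalabanUVNodesN11Sect3SupplyChainObligationsDefs
open BalabanUVNodesN11Sect3SupplyChainBorelBThm1PrintedOfSolvable (provisos₁₃SepCoPH_gaussPinH)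
open BalabanUVNodesN11Sect3SupplyChainBorelBThm1PrintedOfLogScalars (supplyChainAt_of_gaussCert_of_supplierBorel_of_nesting_of_logScalars)
open BalabanUVNodesN11NodeFaceOfCompatibleSupplyChain (b14_main_leavesP_of_supplyChainAt_of_compatible_of_topDvd b14_main_leavesP_of_supplyChainAt_of_compatible_of_floor
  b14_main_leavesP_of_thm2Regime_of_supplyChainAt_of_compatible)

variable {F : T4Family} {N : ℕ} [NeZero N]

/-! ## §1  Per run: N11's node on a run whose top cube fits (resp. above the floor) — E's token at dag-n11-w4's socket -/

section PerRun

variable (θ : Stage13HParams F N) (p : B12.RunParams)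

/-- **★★ N11's DAG NODE `Dag.B14_main (leavesP w p)` ON THE SupplierBorel ROAD ON A RUN WHOSE TOP 𝐃_K-CUBE FITS — NO GUARD BINDER, NO bg-FACT BINDER** (world bound to the K1-keyed
SepCoPH datum of a Gaussian-class `θ` on the live-selector line, `w.γ ≤ θ.γ`, `0 ≤ w.βup`, `w.βup·w.γ² ≤ 1`; `M = L^a`, `r = 1`): dag-n11-w4 g5's
`b14_main_leavesP_of_supplyChainAt_of_compatible_of_topDvd` — the guard `PartCompat₁₃ θ p p.K` produced inside the node from `smallCouplings` + `flowControl` ((2.6)) + `htop` — with its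
chain binder `hN` DISCHARGED by this seat's E token `supplyChainAt_of_gaussCert_of_supplierBorel_of_nesting_of_logScalars` (window `]0, w.γ] ⊆ ]0, θ.γ]`).  Displayed for the run: K0's
per-cube [15]-solvability, [III] §3's supplier with `SupplierObligations ∧ SupplierBorel`; θ-level: certificate, key, `0 < M₁ ≤ M`, `2 ≤ cR`, `L·M₂ ∣ M`, the `M₂`-light log scalars.
[cite: Balaban1988Convergent, Thm 1 p.262, Theorem p.245, p.244 L36–38, §3 p.279, (2.4)–(2.6) p.255, p.257, (2.28) p.259, (3.24)–(3.25) p.270; Balaban1987RG1, Thm 1 p.259, (0.20) p.256, (1.20)–(1.22) p.264; Balaban1989LargeFieldI, (0.3)–(0.4) p.176, p.177 (i)–(ii); Balaban1985Variational, Thm 1 (7)–(8) pp.278–279] -/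
theorem b14_main_leavesP_of_gaussCert_of_supplierBorel_of_logScalars_of_topDvd
    (hζ : ∀ (p' : B12.RunParams) (n : ℕ) (Ω Λ : ℕ → Set (Site (F.P p'.K) 0)), (θ.Zh p' n Ω Λ).ζ0 = (ZhPinOfRecord₁₃ θ.toStage13Params p' Ω Λ).ζ0)
    (hq : ∀ (p' : B12.RunParams) (n : ℕ) (Ω Λ : ℕ → Set (Site (F.P p'.K) 0)) (j : ℕ) (Λ' : Set (Site (F.P p'.K) 0)) (ω : MultiCfg (F.P p'.K) (SU N) (FluctV N)),
      (θ.Zh p' n Ω Λ).quad j Λ' ω = ∑ b ∈ (Set.toFinite (bondsIn j (Λ'ᶜ ∩ Ω (j + 1)))).toFinset, ‖(ω j).2 b‖ ^ 2)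
    (h : θ.Provisos₁₃SepCoPH F N) (hsel : θ.ppSel = ppSelLiveOfRecord F N θ.ν θ.τ9 (EOfRecord₁₃ F N θ.toStage13Params) (wOfRecord₉ F N θ.toStage9Params))
    (hθ : θ.Admissible F N) (hκ : 0 ≤ θ.s2.lf.κ) (hE₀ : 0 ≤ θ.s2.lf.E₀) (hB₀ : 0 ≤ θ.s2.lf.B₀)
    (hM₁ : 0 < θ.ν.M₁) (hle : θ.ν.M₁ ≤ θ.τ9.M) (hcR : 2 ≤ θ.s2.cR) (hdiv : F.L * θ.ν.M₂ ∣ θ.τ9.M)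
    (hM3 : (3 * θ.ν.M₁ : ℝ) ≤ F.L * θ.ν.M₂ * (Real.log (θ.γ ^ 2)⁻¹) ^ θ.ν.r)
    (hMd : (((4 + 4) * F.L + 3 : ℕ) : ℝ) ≤ F.L * θ.ν.M₂ * (Real.log (θ.γ ^ 2)⁻¹) ^ θ.ν.r)
    (hA : 0 < θ.ν.A₀) (hγ1 : θ.γ < 1) (hγp : θ.γ ≤ Real.exp (-(θ.ν.p₀ : ℝ)))
    (hg3 : (143 * ((((8 : ℕ) : ℝ)) ^ 2 / 4) ^ 2) * (θ.γ * (θ.ν.A₀ * (Real.log (θ.γ ^ 2)⁻¹) ^ θ.ν.p₀)) ≤ 1 / 3)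
    (hg2 : 2 * (θ.γ * (θ.ν.A₀ * (Real.log (θ.γ ^ 2)⁻¹) ^ θ.ν.p₀)) ≤ 2 * ExpMeanLog.deltaSU (Fin N) / (((8 * F.L : ℕ) : ℝ)) ^ 2)
    {a : ℕ} (hMa : θ.τ9.M = F.L ^ a) (hr : θ.ν.r = 1)
    (w : WorldP) (hC : w.C = (datumOfRecord₁₃SepCoPH F N θ h).C) (hγw : w.γ ≤ θ.γ) (hβ : 0 ≤ w.βup) (hβγ : w.βup * w.γ ^ 2 ≤ 1)
    (htop : dCubeSide (F.P p.K).L θ.τ9.M (RkOfRecord (F.P p.K).L θ.ν.r (gOfRecord₁₃ F N θ.toStage13Params p p.K)) p.K ∣ (F.P p.K).sitesPerDir 0)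
    (hsolv : ∀ j, 1 ≤ j → j ≤ p.K →
      ∀ (s : SeqOfRecord F θ.ν θ.τ9.M (gOfRecord₁₃ F N θ.toStage13Params p) p.K j) (V : GaugeField (F.P p.K) j (SU N)),
      chiSeqOfRecord F N θ.ν θ.τ9.M (gOfRecord₁₃ F N θ.toStage13Params p) p.K j s V ≠ 0 →
      ∀ a ∈ cubesIn (fun a : ↥(cubeIndices (F.P p.K) (cubeSide (F.P p.K).L θ.ν.M₂ (RkOfRecord (F.P p.K).L θ.ν.r (gOfRecord₁₃ F N θ.toStage13Params p j)) j)) =>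
          cubeEnl (F.P p.K) (cubeSide (F.P p.K).L θ.ν.M₂ (RkOfRecord (F.P p.K).L θ.ν.r (gOfRecord₁₃ F N θ.toStage13Params p j)) j) a 0) (s.Ω j),
        ∃ U₀, IsMinimizer (avOfRecord F N p.K) {U | PlaqSmall (θ.ν.εreg * (F.P p.K).eta j ^ 2) U}
          (Bj θ.ν.M₁ (cubeEnl (F.P p.K) (cubeSide (F.P p.K).L θ.ν.M₂ (RkOfRecord (F.P p.K).L θ.ν.r (gOfRecord₁₃ F N θ.toStage13Params p j)) j) a 4) j)
          (avgFamily (avOfRecord F N p.K) (qsstarGIter0 j V)) U₀)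
    (σ : Sect3Supplier θ p) (hσ : SupplierObligations θ p σ) (hσB : SupplierBorel θ p σ) : Dag.B14_main (leavesP w p) :=
  b14_main_leavesP_of_supplyChainAt_of_compatible_of_topDvd h hsel hθ hκ hE₀ hB₀ hMa hr w hC hβ hβγ p htop fun hw hPC =>
    supplyChainAt_of_gaussCert_of_supplierBorel_of_nesting_of_logScalars θ p hζ hq h hθ hM₁ hle hcR hdiv hM3 hMd hA hγ1 hγp hg3 hg2
      (fun j hj => ⟨(hw j hj).1, (hw j hj).2.trans hγw⟩) hPC hsolv σ hσ hσB

/-- **★★ THE SAME ABOVE THE FLOOR** (`a ≤ m`, `0 ≤ w.βup`; no `βup·γ² ≤ 1`): on a run whose LAST coupling clears `log(1∕g_K² + w.βup) ≤ L^{m−a}`, N11's node on the SupplierBorel road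
with K0's guarded row — dag-n11-w4 g5's `…_of_compatible_of_floor` at this seat's E token.  Supersedes this seat's H4 in kind: the β-ceiling letter along the run is no longer asked
(it is the node's own (2.6)). [cite: Balaban1988Convergent, Thm 1 p.262, Theorem p.245, (2.6) p.255, p.257, (2.28) p.259; Balaban1987RG1, (0.31) p.259, (1.20)–(1.22) p.264; Balaban1985Variational, Thm 1 (7)–(8) pp.278–279] -/
theorem b14_main_leavesP_of_gaussCert_of_supplierBorel_of_logScalars_of_floor
    (hζ : ∀ (p' : B12.RunParams) (n : ℕ) (Ω Λ : ℕ → Set (Site (F.P p'.K) 0)), (θ.Zh p' n Ω Λ).ζ0 = (ZhPinOfRecord₁₃ θ.toStage13Params p' Ω Λ).ζ0)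
    (hq : ∀ (p' : B12.RunParams) (n : ℕ) (Ω Λ : ℕ → Set (Site (F.P p'.K) 0)) (j : ℕ) (Λ' : Set (Site (F.P p'.K) 0)) (ω : MultiCfg (F.P p'.K) (SU N) (FluctV N)),
      (θ.Zh p' n Ω Λ).quad j Λ' ω = ∑ b ∈ (Set.toFinite (bondsIn j (Λ'ᶜ ∩ Ω (j + 1)))).toFinset, ‖(ω j).2 b‖ ^ 2)
    (h : θ.Provisos₁₃SepCoPH F N) (hsel : θ.ppSel = ppSelLiveOfRecord F N θ.ν θ.τ9 (EOfRecord₁₃ F N θ.toStage13Params) (wOfRecord₉ F N θ.toStage9Params))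
    (hθ : θ.Admissible F N) (hκ : 0 ≤ θ.s2.lf.κ) (hE₀ : 0 ≤ θ.s2.lf.E₀) (hB₀ : 0 ≤ θ.s2.lf.B₀)
    (hM₁ : 0 < θ.ν.M₁) (hle : θ.ν.M₁ ≤ θ.τ9.M) (hcR : 2 ≤ θ.s2.cR) (hdiv : F.L * θ.ν.M₂ ∣ θ.τ9.M)
    (hM3 : (3 * θ.ν.M₁ : ℝ) ≤ F.L * θ.ν.M₂ * (Real.log (θ.γ ^ 2)⁻¹) ^ θ.ν.r)
    (hMd : (((4 + 4) * F.L + 3 : ℕ) : ℝ) ≤ F.L * θ.ν.M₂ * (Real.log (θ.γ ^ 2)⁻¹) ^ θ.ν.r)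
    (hA : 0 < θ.ν.A₀) (hγ1 : θ.γ < 1) (hγp : θ.γ ≤ Real.exp (-(θ.ν.p₀ : ℝ)))
    (hg3 : (143 * ((((8 : ℕ) : ℝ)) ^ 2 / 4) ^ 2) * (θ.γ * (θ.ν.A₀ * (Real.log (θ.γ ^ 2)⁻¹) ^ θ.ν.p₀)) ≤ 1 / 3)
    (hg2 : 2 * (θ.γ * (θ.ν.A₀ * (Real.log (θ.γ ^ 2)⁻¹) ^ θ.ν.p₀)) ≤ 2 * ExpMeanLog.deltaSU (Fin N) / (((8 * F.L : ℕ) : ℝ)) ^ 2)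
    {a : ℕ} (hMa : θ.τ9.M = F.L ^ a) (hr : θ.ν.r = 1) (ha : a ≤ F.m)
    (w : WorldP) (hC : w.C = (datumOfRecord₁₃SepCoPH F N θ h).C) (hγw : w.γ ≤ θ.γ) (hβ : 0 ≤ w.βup)
    (hfloor : Real.log (1 / gOfRecord₁₃ F N θ.toStage13Params p p.K ^ 2 + w.βup) ≤ ((F.L ^ (F.m - a) : ℕ) : ℝ))
    (hsolv : ∀ j, 1 ≤ j → j ≤ p.K →
      ∀ (s : SeqOfRecord F θ.ν θ.τ9.M (gOfRecord₁₃ F N θ.toStage13Params p) p.K j) (V : GaugeField (F.P p.K) j (SU N)),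
      chiSeqOfRecord F N θ.ν θ.τ9.M (gOfRecord₁₃ F N θ.toStage13Params p) p.K j s V ≠ 0 →
      ∀ a ∈ cubesIn (fun a : ↥(cubeIndices (F.P p.K) (cubeSide (F.P p.K).L θ.ν.M₂ (RkOfRecord (F.P p.K).L θ.ν.r (gOfRecord₁₃ F N θ.toStage13Params p j)) j)) =>
          cubeEnl (F.P p.K) (cubeSide (F.P p.K).L θ.ν.M₂ (RkOfRecord (F.P p.K).L θ.ν.r (gOfRecord₁₃ F N θ.toStage13Params p j)) j) a 0) (s.Ω j),
        ∃ U₀, IsMinimizer (avOfRecord F N p.K) {U | PlaqSmall (θ.ν.εreg * (F.P p.K).eta j ^ 2) U}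
          (Bj θ.ν.M₁ (cubeEnl (F.P p.K) (cubeSide (F.P p.K).L θ.ν.M₂ (RkOfRecord (F.P p.K).L θ.ν.r (gOfRecord₁₃ F N θ.toStage13Params p j)) j) a 4) j)
          (avgFamily (avOfRecord F N p.K) (qsstarGIter0 j V)) U₀)
    (σ : Sect3Supplier θ p) (hσ : SupplierObligations θ p σ) (hσB : SupplierBorel θ p σ) : Dag.B14_main (leavesP w p) :=
  b14_main_leavesP_of_supplyChainAt_of_compatible_of_floor h hsel hθ hκ hE₀ hB₀ hMa hr ha w hC hβ p hfloor fun hw hPC =>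
    supplyChainAt_of_gaussCert_of_supplierBorel_of_nesting_of_logScalars θ p hζ hq h hθ hM₁ hle hcR hdiv hM3 hMd hA hγ1 hγp hg3 hg2
      (fun j hj => ⟨(hw j hj).1, (hw j hj).2.trans hγw⟩) hPC hsolv σ hσ hσB

end PerRun

/-! ## §2  All runs whose top cube fits: rows keyed on the window `]0, θ.γ]` -/

section AllRuns

variable (θ : Stage13HParams F N)

/-- **★★★ N11's NODE ON EVERY RUN WHOSE TOP CUBE FITS, ON THE SupplierBorel ROAD WITH K0's GUARDED ROW ONLY** — at any world bound to the K1-keyed SepCoPH datum of a Gaussian-class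
`θ` with `w.γ ≤ θ.γ`, `0 ≤ w.βup`, `w.βup·w.γ² ≤ 1`; per windowed run (`Step.InInterval θ.γ P.K (gOfRecord₁₃ θ P)`) K0's per-cube [15]-solvability and [III] §3's supplier with
`SupplierObligations ∧ SupplierBorel`.  The complement — window runs whose top cube does NOT fit, a top segment of one-block levels under (2.6) (dag-n11-w4 g5
`not_dvdAt_mono_of_flowIneq26`) — is served by this seat's FILE 1 (bg-facts road) and is not claimed here. [cite: Balaban1988Convergent, Thm 1 p.262, Theorem p.245, p.244 L36–38, §3 p.279, (2.4)–(2.6) p.255, p.257, (2.28) p.259, (3.24)–(3.25) p.270; Balaban1987RG1, Thm 1 p.259, (0.20) p.256, (1.20)–(1.22) p.264; Balaban1989LargeFieldII, Introduction pp.355–356; Balaban1989LargeFieldI, (0.3)–(0.4) p.176; Balaban1985Variational, Thm 1 (7)–(8) pp.278–279] -/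
theorem b14_main_leavesP_all_of_gaussCert_of_supplierBorel_of_logScalars_of_topDvd
    (hζ : ∀ (p : B12.RunParams) (n : ℕ) (Ω Λ : ℕ → Set (Site (F.P p.K) 0)), (θ.Zh p n Ω Λ).ζ0 = (ZhPinOfRecord₁₃ θ.toStage13Params p Ω Λ).ζ0)
    (hq : ∀ (p : B12.RunParams) (n : ℕ) (Ω Λ : ℕ → Set (Site (F.P p.K) 0)) (j : ℕ) (Λ' : Set (Site (F.P p.K) 0)) (ω : MultiCfg (F.P p.K) (SU N) (FluctV N)),
      (θ.Zh p n Ω Λ).quad j Λ' ω = ∑ b ∈ (Set.toFinite (bondsIn j (Λ'ᶜ ∩ Ω (j + 1)))).toFinset, ‖(ω j).2 b‖ ^ 2)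
    (h : θ.Provisos₁₃SepCoPH F N) (hsel : θ.ppSel = ppSelLiveOfRecord F N θ.ν θ.τ9 (EOfRecord₁₃ F N θ.toStage13Params) (wOfRecord₉ F N θ.toStage9Params))
    (hθ : θ.Admissible F N) (hκ : 0 ≤ θ.s2.lf.κ) (hE₀ : 0 ≤ θ.s2.lf.E₀) (hB₀ : 0 ≤ θ.s2.lf.B₀)
    (hM₁ : 0 < θ.ν.M₁) (hle : θ.ν.M₁ ≤ θ.τ9.M) (hcR : 2 ≤ θ.s2.cR) (hdiv : F.L * θ.ν.M₂ ∣ θ.τ9.M)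
    (hM3 : (3 * θ.ν.M₁ : ℝ) ≤ F.L * θ.ν.M₂ * (Real.log (θ.γ ^ 2)⁻¹) ^ θ.ν.r)
    (hMd : (((4 + 4) * F.L + 3 : ℕ) : ℝ) ≤ F.L * θ.ν.M₂ * (Real.log (θ.γ ^ 2)⁻¹) ^ θ.ν.r)
    (hA : 0 < θ.ν.A₀) (hγ1 : θ.γ < 1) (hγp : θ.γ ≤ Real.exp (-(θ.ν.p₀ : ℝ)))
    (hg3 : (143 * ((((8 : ℕ) : ℝ)) ^ 2 / 4) ^ 2) * (θ.γ * (θ.ν.A₀ * (Real.log (θ.γ ^ 2)⁻¹) ^ θ.ν.p₀)) ≤ 1 / 3)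
    (hg2 : 2 * (θ.γ * (θ.ν.A₀ * (Real.log (θ.γ ^ 2)⁻¹) ^ θ.ν.p₀)) ≤ 2 * ExpMeanLog.deltaSU (Fin N) / (((8 * F.L : ℕ) : ℝ)) ^ 2)
    {a : ℕ} (hMa : θ.τ9.M = F.L ^ a) (hr : θ.ν.r = 1)
    (hsolv : ∀ P : B12.RunParams, Step.InInterval θ.γ P.K (gOfRecord₁₃ F N θ.toStage13Params P) → ∀ j, 1 ≤ j → j ≤ P.K →
      ∀ (s : SeqOfRecord F θ.ν θ.τ9.M (gOfRecord₁₃ F N θ.toStage13Params P) P.K j) (V : GaugeField (F.P P.K) j (SU N)),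
      chiSeqOfRecord F N θ.ν θ.τ9.M (gOfRecord₁₃ F N θ.toStage13Params P) P.K j s V ≠ 0 →
      ∀ a ∈ cubesIn (fun a : ↥(cubeIndices (F.P P.K) (cubeSide (F.P P.K).L θ.ν.M₂ (RkOfRecord (F.P P.K).L θ.ν.r (gOfRecord₁₃ F N θ.toStage13Params P j)) j)) =>
          cubeEnl (F.P P.K) (cubeSide (F.P P.K).L θ.ν.M₂ (RkOfRecord (F.P P.K).L θ.ν.r (gOfRecord₁₃ F N θ.toStage13Params P j)) j) a 0) (s.Ω j),
        ∃ U₀, IsMinimizer (avOfRecord F N P.K) {U | PlaqSmall (θ.ν.εreg * (F.P P.K).eta j ^ 2) U}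
          (Bj θ.ν.M₁ (cubeEnl (F.P P.K) (cubeSide (F.P P.K).L θ.ν.M₂ (RkOfRecord (F.P P.K).L θ.ν.r (gOfRecord₁₃ F N θ.toStage13Params P j)) j) a 4) j)
          (avgFamily (avOfRecord F N P.K) (qsstarGIter0 j V)) U₀)
    (σ : (P : B12.RunParams) → Sect3Supplier θ P)
    (hσ : ∀ P : B12.RunParams, Step.InInterval θ.γ P.K (gOfRecord₁₃ F N θ.toStage13Params P) → SupplierObligations θ P (σ P))
    (hσB : ∀ P : B12.RunParams, Step.InInterval θ.γ P.K (gOfRecord₁₃ F N θ.toStage13Params P) → SupplierBorel θ P (σ P))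
    (w : WorldP) (hC : w.C = (datumOfRecord₁₃SepCoPH F N θ h).C) (hγw : w.γ ≤ θ.γ) (hβ : 0 ≤ w.βup) (hβγ : w.βup * w.γ ^ 2 ≤ 1) :
    ∀ P : B12.RunParams,
      dCubeSide (F.P P.K).L θ.τ9.M (RkOfRecord (F.P P.K).L θ.ν.r (gOfRecord₁₃ F N θ.toStage13Params P P.K)) P.K ∣ (F.P P.K).sitesPerDir 0 →
        Dag.B14_main (leavesP w P) := fun P htop =>
  b14_main_leavesP_of_supplyChainAt_of_compatible_of_topDvd h hsel hθ hκ hE₀ hB₀ hMa hr w hC hβ hβγ P htop fun hw hPC =>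
    have hW : Step.InInterval θ.γ P.K (gOfRecord₁₃ F N θ.toStage13Params P) := fun j hj => ⟨(hw j hj).1, (hw j hj).2.trans hγw⟩
    supplyChainAt_of_gaussCert_of_supplierBorel_of_nesting_of_logScalars θ P hζ hq h hθ hM₁ hle hcR hdiv hM3 hMd hA hγ1 hγp hg3 hg2 hW hPC
      (hsolv P hW) (σ P) (hσ P hW) (hσB P hW)

end AllRuns

/-! ## §3  [I] Thm 2's regime: N11's node on every Thm-2-regime run from ONE world-level divisibility -/

section Thm2

variable (θ : Stage13HParams F N)

/-- **★★★ N11's NODE ON EVERY RUN OF [I] THM 2's REGIME (`g_K = w.gR`), ON THE SupplierBorel ROAD WITH K0's GUARDED ROW ONLY — ONE WORLD-LEVEL DIVISIBILITY `M·R_K(w.gR) ∣ 2L^m`**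
(dag-n11-w4 g5's `b14_main_leavesP_of_thm2Regime_of_supplyChainAt_of_compatible` at this seat's E token): the located item (n2) of this seat's g3 close, settled on the node road — at a
world bound to the K1-keyed SepCoPH datum (`w.γ ≤ θ.γ`, `0 ≤ w.βup`, `w.βup·w.γ² ≤ 1`, `M = L^a`, `r = 1`), every run in the Thm-2 leaf (an extra HYPOTHESIS on the run, not an antecedent of
`Dag.B14_main`) carries N11's node from the windowed rows of §2.  [I] Thm 2 is UNPROVED in print; its regime is a leaf here. [cite: Balaban1987RG1, Thm 2 + (0.31) p.259, (0.20) p.256; Balaban1988Convergent, Thm 1 p.262, Theorem p.245, (2.6) p.255, p.257, (2.28) p.259; Balaban1985Variational, Thm 1 (7)–(8) pp.278–279] -/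
theorem b14_main_leavesP_all_of_thm2Regime_of_gaussCert_of_supplierBorel_of_logScalars
    (hζ : ∀ (p : B12.RunParams) (n : ℕ) (Ω Λ : ℕ → Set (Site (F.P p.K) 0)), (θ.Zh p n Ω Λ).ζ0 = (ZhPinOfRecord₁₃ θ.toStage13Params p Ω Λ).ζ0)
    (hq : ∀ (p : B12.RunParams) (n : ℕ) (Ω Λ : ℕ → Set (Site (F.P p.K) 0)) (j : ℕ) (Λ' : Set (Site (F.P p.K) 0)) (ω : MultiCfg (F.P p.K) (SU N) (FluctV N)),
      (θ.Zh p n Ω Λ).quad j Λ' ω = ∑ b ∈ (Set.toFinite (bondsIn j (Λ'ᶜ ∩ Ω (j + 1)))).toFinset, ‖(ω j).2 b‖ ^ 2)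
    (h : θ.Provisos₁₃SepCoPH F N) (hsel : θ.ppSel = ppSelLiveOfRecord F N θ.ν θ.τ9 (EOfRecord₁₃ F N θ.toStage13Params) (wOfRecord₉ F N θ.toStage9Params))
    (hθ : θ.Admissible F N) (hκ : 0 ≤ θ.s2.lf.κ) (hE₀ : 0 ≤ θ.s2.lf.E₀) (hB₀ : 0 ≤ θ.s2.lf.B₀)
    (hM₁ : 0 < θ.ν.M₁) (hle : θ.ν.M₁ ≤ θ.τ9.M) (hcR : 2 ≤ θ.s2.cR) (hdiv : F.L * θ.ν.M₂ ∣ θ.τ9.M)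
    (hM3 : (3 * θ.ν.M₁ : ℝ) ≤ F.L * θ.ν.M₂ * (Real.log (θ.γ ^ 2)⁻¹) ^ θ.ν.r)
    (hMd : (((4 + 4) * F.L + 3 : ℕ) : ℝ) ≤ F.L * θ.ν.M₂ * (Real.log (θ.γ ^ 2)⁻¹) ^ θ.ν.r)
    (hA : 0 < θ.ν.A₀) (hγ1 : θ.γ < 1) (hγp : θ.γ ≤ Real.exp (-(θ.ν.p₀ : ℝ)))
    (hg3 : (143 * ((((8 : ℕ) : ℝ)) ^ 2 / 4) ^ 2) * (θ.γ * (θ.ν.A₀ * (Real.log (θ.γ ^ 2)⁻¹) ^ θ.ν.p₀)) ≤ 1 / 3)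
    (hg2 : 2 * (θ.γ * (θ.ν.A₀ * (Real.log (θ.γ ^ 2)⁻¹) ^ θ.ν.p₀)) ≤ 2 * ExpMeanLog.deltaSU (Fin N) / (((8 * F.L : ℕ) : ℝ)) ^ 2)
    {a : ℕ} (hMa : θ.τ9.M = F.L ^ a) (hr : θ.ν.r = 1)
    (hsolv : ∀ P : B12.RunParams, Step.InInterval θ.γ P.K (gOfRecord₁₃ F N θ.toStage13Params P) → ∀ j, 1 ≤ j → j ≤ P.K →
      ∀ (s : SeqOfRecord F θ.ν θ.τ9.M (gOfRecord₁₃ F N θ.toStage13Params P) P.K j) (V : GaugeField (F.P P.K) j (SU N)),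
      chiSeqOfRecord F N θ.ν θ.τ9.M (gOfRecord₁₃ F N θ.toStage13Params P) P.K j s V ≠ 0 →
      ∀ a ∈ cubesIn (fun a : ↥(cubeIndices (F.P P.K) (cubeSide (F.P P.K).L θ.ν.M₂ (RkOfRecord (F.P P.K).L θ.ν.r (gOfRecord₁₃ F N θ.toStage13Params P j)) j)) =>
          cubeEnl (F.P P.K) (cubeSide (F.P P.K).L θ.ν.M₂ (RkOfRecord (F.P P.K).L θ.ν.r (gOfRecord₁₃ F N θ.toStage13Params P j)) j) a 0) (s.Ω j),
        ∃ U₀, IsMinimizer (avOfRecord F N P.K) {U | PlaqSmall (θ.ν.εreg * (F.P P.K).eta j ^ 2) U}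
          (Bj θ.ν.M₁ (cubeEnl (F.P P.K) (cubeSide (F.P P.K).L θ.ν.M₂ (RkOfRecord (F.P P.K).L θ.ν.r (gOfRecord₁₃ F N θ.toStage13Params P j)) j) a 4) j)
          (avgFamily (avOfRecord F N P.K) (qsstarGIter0 j V)) U₀)
    (σ : (P : B12.RunParams) → Sect3Supplier θ P)
    (hσ : ∀ P : B12.RunParams, Step.InInterval θ.γ P.K (gOfRecord₁₃ F N θ.toStage13Params P) → SupplierObligations θ P (σ P))
    (hσB : ∀ P : B12.RunParams, Step.InInterval θ.γ P.K (gOfRecord₁₃ F N θ.toStage13Params P) → SupplierBorel θ P (σ P))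
    (w : WorldP) (hC : w.C = (datumOfRecord₁₃SepCoPH F N θ h).C) (hγw : w.γ ≤ θ.γ) (hβ : 0 ≤ w.βup) (hβγ : w.βup * w.γ ^ 2 ≤ 1)
    (hdvd : θ.τ9.M * RkOfRecord F.L θ.ν.r w.gR ∣ 2 * F.L ^ F.m) :
    ∀ P : B12.RunParams, (leavesP w P).thm2Regime → Dag.B14_main (leavesP w P) := fun P hreg =>
  b14_main_leavesP_of_thm2Regime_of_supplyChainAt_of_compatible h hsel hθ hκ hE₀ hB₀ hMa hr w hC hβ hβγ hdvd P hreg fun hw hPC =>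
    have hW : Step.InInterval θ.γ P.K (gOfRecord₁₃ F N θ.toStage13Params P) := fun j hj => ⟨(hw j hj).1, (hw j hj).2.trans hγw⟩
    supplyChainAt_of_gaussCert_of_supplierBorel_of_nesting_of_logScalars θ P hζ hq h hθ hM₁ hle hcR hdiv hM3 hMd hA hγ1 hγp hg3 hg2 hW hPC
      (hsolv P hW) (σ P) (hσ P hW) (hσB P hW)

end Thm2

/-! ## §4  The editions at the NAMED Gaussian certificate `gaussPinH θ` — no class hypothesis -/

section Named

variable (θ : Stage13HParams F N)

/-- **★★ N11's NODE ON EVERY RUN WHOSE TOP CUBE FITS, AT A WORLD BOUND TO THE K1-KEYED DATUM OF THE NAMED CERTIFICATE `gaussPinH θ`** — §2 with the class hypotheses discharged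
(`gaussPinH_ζ0 ∕ gaussPinH_quad`, `rfl`) and the key transferred (`provisos₁₃SepCoPH_gaussPinH`); the rows, stated over `θ`'s Stage-13 letters, serve the certificate verbatim (it shares
`θ.toStage13RParams`). [cite: Balaban1988Convergent, Thm 1 p.262, Theorem p.245, p.244 L36–38, §3 p.279, (2.6) p.255, p.257, (2.28) p.259, (3.16) p.268; Balaban1987RG1, Thm 1 p.259, (1.20)–(1.22) p.264; Balaban1989LargeFieldI, (0.3)–(0.4) p.176; Balaban1985Variational, Thm 1 (7)–(8) pp.278–279] -/
theorem b14_main_leavesP_all_gaussPinH_of_supplierBorel_of_logScalars_of_topDvd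
    (h : θ.Provisos₁₃SepCoPH F N) (hsel : θ.ppSel = ppSelLiveOfRecord F N θ.ν θ.τ9 (EOfRecord₁₃ F N θ.toStage13Params) (wOfRecord₉ F N θ.toStage9Params))
    (hθ : θ.Admissible F N) (hκ : 0 ≤ θ.s2.lf.κ) (hE₀ : 0 ≤ θ.s2.lf.E₀) (hB₀ : 0 ≤ θ.s2.lf.B₀)
    (hM₁ : 0 < θ.ν.M₁) (hle : θ.ν.M₁ ≤ θ.τ9.M) (hcR : 2 ≤ θ.s2.cR) (hdiv : F.L * θ.ν.M₂ ∣ θ.τ9.M)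
    (hM3 : (3 * θ.ν.M₁ : ℝ) ≤ F.L * θ.ν.M₂ * (Real.log (θ.γ ^ 2)⁻¹) ^ θ.ν.r)
    (hMd : (((4 + 4) * F.L + 3 : ℕ) : ℝ) ≤ F.L * θ.ν.M₂ * (Real.log (θ.γ ^ 2)⁻¹) ^ θ.ν.r)
    (hA : 0 < θ.ν.A₀) (hγ1 : θ.γ < 1) (hγp : θ.γ ≤ Real.exp (-(θ.ν.p₀ : ℝ)))
    (hg3 : (143 * ((((8 : ℕ) : ℝ)) ^ 2 / 4) ^ 2) * (θ.γ * (θ.ν.A₀ * (Real.log (θ.γ ^ 2)⁻¹) ^ θ.ν.p₀)) ≤ 1 / 3)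
    (hg2 : 2 * (θ.γ * (θ.ν.A₀ * (Real.log (θ.γ ^ 2)⁻¹) ^ θ.ν.p₀)) ≤ 2 * ExpMeanLog.deltaSU (Fin N) / (((8 * F.L : ℕ) : ℝ)) ^ 2)
    {a : ℕ} (hMa : θ.τ9.M = F.L ^ a) (hr : θ.ν.r = 1)
    (hsolv : ∀ P : B12.RunParams, Step.InInterval θ.γ P.K (gOfRecord₁₃ F N θ.toStage13Params P) → ∀ j, 1 ≤ j → j ≤ P.K →
      ∀ (s : SeqOfRecord F θ.toStage13Params.ν θ.toStage13Params.τ9.M (gOfRecord₁₃ F N θ.toStage13Params P) P.K j) (V : GaugeField (F.P P.K) j (SU N)),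
      chiSeqOfRecord F N θ.toStage13Params.ν θ.toStage13Params.τ9.M (gOfRecord₁₃ F N θ.toStage13Params P) P.K j s V ≠ 0 →
      ∀ a ∈ cubesIn (fun a : ↥(cubeIndices (F.P P.K) (cubeSide (F.P P.K).L θ.toStage13Params.ν.M₂ (RkOfRecord (F.P P.K).L θ.toStage13Params.ν.r (gOfRecord₁₃ F N θ.toStage13Params P j)) j)) =>
          cubeEnl (F.P P.K) (cubeSide (F.P P.K).L θ.toStage13Params.ν.M₂ (RkOfRecord (F.P P.K).L θ.toStage13Params.ν.r (gOfRecord₁₃ F N θ.toStage13Params P j)) j) a 0) (s.Ω j),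
        ∃ U₀, IsMinimizer (avOfRecord F N P.K) {U | PlaqSmall (θ.toStage13Params.ν.εreg * (F.P P.K).eta j ^ 2) U}
          (Bj θ.toStage13Params.ν.M₁ (cubeEnl (F.P P.K) (cubeSide (F.P P.K).L θ.toStage13Params.ν.M₂ (RkOfRecord (F.P P.K).L θ.toStage13Params.ν.r (gOfRecord₁₃ F N θ.toStage13Params P j)) j) a 4) j)
          (avgFamily (avOfRecord F N P.K) (qsstarGIter0 j V)) U₀)
    (σ : (P : B12.RunParams) → Sect3Supplier (gaussPinH θ) P)
    (hσ : ∀ P : B12.RunParams, Step.InInterval θ.γ P.K (gOfRecord₁₃ F N θ.toStage13Params P) → SupplierObligations (gaussPinH θ) P (σ P))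
    (hσB : ∀ P : B12.RunParams, Step.InInterval θ.γ P.K (gOfRecord₁₃ F N θ.toStage13Params P) → SupplierBorel (gaussPinH θ) P (σ P))
    (w : WorldP) (hC : w.C = (datumOfRecord₁₃SepCoPH F N (gaussPinH θ) (provisos₁₃SepCoPH_gaussPinH h)).C) (hγw : w.γ ≤ θ.γ) (hβ : 0 ≤ w.βup)
    (hβγ : w.βup * w.γ ^ 2 ≤ 1) :
    ∀ P : B12.RunParams,
      dCubeSide (F.P P.K).L θ.τ9.M (RkOfRecord (F.P P.K).L θ.ν.r (gOfRecord₁₃ F N θ.toStage13Params P P.K)) P.K ∣ (F.P P.K).sitesPerDir 0 →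
        Dag.B14_main (leavesP w P) :=
  b14_main_leavesP_all_of_gaussCert_of_supplierBorel_of_logScalars_of_topDvd (gaussPinH θ) (gaussPinH_ζ0 θ) (gaussPinH_quad θ) (provisos₁₃SepCoPH_gaussPinH h) hsel
    hθ hκ hE₀ hB₀ hM₁ hle hcR hdiv hM3 hMd hA hγ1 hγp hg3 hg2 hMa hr hsolv σ hσ hσB w hC hγw hβ hβγ

/-- **★★ N11's NODE ON EVERY THM-2-REGIME RUN AT A WORLD BOUND TO THE K1-KEYED DATUM OF `gaussPinH θ`** — §3 with the class hypotheses discharged and the key transferred; one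
world-level divisibility `M·R_K(w.gR) ∣ 2L^m`. [cite: Balaban1987RG1, Thm 2 + (0.31) p.259; Balaban1988Convergent, Thm 1 p.262, Theorem p.245, (2.6) p.255, p.257, (2.28) p.259, (3.16) p.268; Balaban1985Variational, Thm 1 (7)–(8) pp.278–279] -/
theorem b14_main_leavesP_all_gaussPinH_of_thm2Regime_of_supplierBorel_of_logScalars
    (h : θ.Provisos₁₃SepCoPH F N) (hsel : θ.ppSel = ppSelLiveOfRecord F N θ.ν θ.τ9 (EOfRecord₁₃ F N θ.toStage13Params) (wOfRecord₉ F N θ.toStage9Params))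
    (hθ : θ.Admissible F N) (hκ : 0 ≤ θ.s2.lf.κ) (hE₀ : 0 ≤ θ.s2.lf.E₀) (hB₀ : 0 ≤ θ.s2.lf.B₀)
    (hM₁ : 0 < θ.ν.M₁) (hle : θ.ν.M₁ ≤ θ.τ9.M) (hcR : 2 ≤ θ.s2.cR) (hdiv : F.L * θ.ν.M₂ ∣ θ.τ9.M)
    (hM3 : (3 * θ.ν.M₁ : ℝ) ≤ F.L * θ.ν.M₂ * (Real.log (θ.γ ^ 2)⁻¹) ^ θ.ν.r)
    (hMd : (((4 + 4) * F.L + 3 : ℕ) : ℝ) ≤ F.L * θ.ν.M₂ * (Real.log (θ.γ ^ 2)⁻¹) ^ θ.ν.r)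
    (hA : 0 < θ.ν.A₀) (hγ1 : θ.γ < 1) (hγp : θ.γ ≤ Real.exp (-(θ.ν.p₀ : ℝ)))
    (hg3 : (143 * ((((8 : ℕ) : ℝ)) ^ 2 / 4) ^ 2) * (θ.γ * (θ.ν.A₀ * (Real.log (θ.γ ^ 2)⁻¹) ^ θ.ν.p₀)) ≤ 1 / 3)
    (hg2 : 2 * (θ.γ * (θ.ν.A₀ * (Real.log (θ.γ ^ 2)⁻¹) ^ θ.ν.p₀)) ≤ 2 * ExpMeanLog.deltaSU (Fin N) / (((8 * F.L : ℕ) : ℝ)) ^ 2)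
    {a : ℕ} (hMa : θ.τ9.M = F.L ^ a) (hr : θ.ν.r = 1)
    (hsolv : ∀ P : B12.RunParams, Step.InInterval θ.γ P.K (gOfRecord₁₃ F N θ.toStage13Params P) → ∀ j, 1 ≤ j → j ≤ P.K →
      ∀ (s : SeqOfRecord F θ.toStage13Params.ν θ.toStage13Params.τ9.M (gOfRecord₁₃ F N θ.toStage13Params P) P.K j) (V : GaugeField (F.P P.K) j (SU N)),
      chiSeqOfRecord F N θ.toStage13Params.ν θ.toStage13Params.τ9.M (gOfRecord₁₃ F N θ.toStage13Params P) P.K j s V ≠ 0 →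
      ∀ a ∈ cubesIn (fun a : ↥(cubeIndices (F.P P.K) (cubeSide (F.P P.K).L θ.toStage13Params.ν.M₂ (RkOfRecord (F.P P.K).L θ.toStage13Params.ν.r (gOfRecord₁₃ F N θ.toStage13Params P j)) j)) =>
          cubeEnl (F.P P.K) (cubeSide (F.P P.K).L θ.toStage13Params.ν.M₂ (RkOfRecord (F.P P.K).L θ.toStage13Params.ν.r (gOfRecord₁₃ F N θ.toStage13Params P j)) j) a 0) (s.Ω j),
        ∃ U₀, IsMinimizer (avOfRecord F N P.K) {U | PlaqSmall (θ.toStage13Params.ν.εreg * (F.P P.K).eta j ^ 2) U}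
          (Bj θ.toStage13Params.ν.M₁ (cubeEnl (F.P P.K) (cubeSide (F.P P.K).L θ.toStage13Params.ν.M₂ (RkOfRecord (F.P P.K).L θ.toStage13Params.ν.r (gOfRecord₁₃ F N θ.toStage13Params P j)) j) a 4) j)
          (avgFamily (avOfRecord F N P.K) (qsstarGIter0 j V)) U₀)
    (σ : (P : B12.RunParams) → Sect3Supplier (gaussPinH θ) P)
    (hσ : ∀ P : B12.RunParams, Step.InInterval θ.γ P.K (gOfRecord₁₃ F N θ.toStage13Params P) → SupplierObligations (gaussPinH θ) P (σ P))
    (hσB : ∀ P : B12.RunParams, Step.InInterval θ.γ P.K (gOfRecord₁₃ F N θ.toStage13Params P) → SupplierBorel (gaussPinH θ) P (σ P))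
    (w : WorldP) (hC : w.C = (datumOfRecord₁₃SepCoPH F N (gaussPinH θ) (provisos₁₃SepCoPH_gaussPinH h)).C) (hγw : w.γ ≤ θ.γ) (hβ : 0 ≤ w.βup)
    (hβγ : w.βup * w.γ ^ 2 ≤ 1) (hdvd : θ.τ9.M * RkOfRecord F.L θ.ν.r w.gR ∣ 2 * F.L ^ F.m) :
    ∀ P : B12.RunParams, (leavesP w P).thm2Regime → Dag.B14_main (leavesP w P) :=
  b14_main_leavesP_all_of_thm2Regime_of_gaussCert_of_supplierBorel_of_logScalars (gaussPinH θ) (gaussPinH_ζ0 θ) (gaussPinH_quad θ) (provisos₁₃SepCoPH_gaussPinH h) hsel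
    hθ hκ hE₀ hB₀ hM₁ hle hcR hdiv hM3 hMd hA hγ1 hγp hg3 hg2 hMa hr hsolv σ hσ hσB w hC hγw hβ hβγ hdvd

end Named

end Summit.QuantumFields.YangMills.Theorems.BalabanUVNodesN11NodeFaceOfCompatibleSupplierBorel

end
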